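import Literature.NumberTheory.LFunctions.WeilMarkovQuadratic
import Literature.NumberTheory.LFunctions.WeilWindowSuzukiProofs
import Literature.NumberTheory.LFunctions.WeilWindowSuzukiAsymptoticProofs

/-!
# Route OddSector, item `OddArchAnchor`: the folded-kernel inequality

Support file for item stmt-RiemannHypothesis-17781 (`OddArchAnchor`) of route `OddSector`.
Normalisation of `Literature/NumberTheory/LFunctions/WeilMarkovQuadratic.lean`: increments
`D_t(f) = weilIncrement f t = ∫ |f(x+t) − f(x)|² dx`, archimedean jump density
`ρ = weilArchDensity` (non-increasing on `(0, ∞)`, `weilArchDensity_antitoneOn`), archimedean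
energy `∫₀^∞ ρ(t) D_t(f) dt`.

**The antisymmetric folding.** For ODD `f` the archimedean energy is a form on the half-line:
`2 ∫₀^∞ ρ(t) D_t(f) dt = 2 ∫∫_{x,s>0} (ρ(|s−x|) |f(s) − f(x)|² + ρ(x+s) |f(s) + f(x)|²) dx ds`
(Tonelli, the substitution `s = x + t`, and the split of both variables into `(0,∞) ∪ (−∞,0)`
with `f(−y) = −f(y)`). Since `ρ(|s−x|) ≥ ρ(x+s)` (the FOLDED KERNEL `ρ(s−x) − ρ(s+x)` is
non-negative because `ρ` decreases) and `|u−v|² + |u+v|² = 2|u|² + 2|v|²`, the integrand does not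
increase when `f = g` is replaced by any odd `h` with `|h(s) − h(x)| ≤ |g(s) − g(x)|` and
`|h(x)| ≤ |g(x)|` for `x, s > 0` — e.g. `h = sign · |g|` or a smooth version of it. This is the
antisymmetric analogue of the Markov property `𝓔(|g|) ≤ 𝓔(g)` and is the mechanism behind the
one-signedness of odd bottom states on the half-window (the prover note of the route review;
Bañuelos–Kulczycki 2004, Thm 4.3, for the Cauchy process).

Main result: `setIntegral_weilArchDensity_mul_weilIncrement_fold_le`.

## References

* R. Bañuelos, T. Kulczycki, *The Cauchy process and the Steklov problem*, J. Funct. Anal. 211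
  (2004), Thm 4.3 (antisymmetric eigenfunctions via the folded kernel).
* S. Jarohs, T. Weth, *Symmetry via antisymmetric maximum principles in nonlocal problems of
  variable order*, Ann. Mat. Pura Appl. 195 (2016), §3 (the folded kernel `k(x−y) − k(x+y) ≥ 0`).
-/

-- `Summit.RiemannHypothesis.RiemannHypothesis.…` repeats the summit name by design (D-0017 layout).
set_option linter.dupNamespace false

noncomputable section

open MeasureTheory Set Filter
open scoped Topology ENNReal

namespace Summit.RiemannHypothesis.RiemannHypothesis.Theorems.OddArchAnchor

open Literature.NumberTheory.LFunctions

/-! ## Tonelli bookkeeping on `ℝ × ℝ` -/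

/-- **Jump-length to pair coordinates**: `∫ k(t) ∫ F(x, x+t) dx dt = ∫∫ k(s−x) F(x, s) ds dx`
(Tonelli and the translation `s = x + t`). -/
theorem lintegral_kernel_shift {k : ℝ → ℝ≥0∞} (hk : Measurable k) {F : ℝ → ℝ → ℝ≥0∞}
    (hF : Measurable (Function.uncurry F)) :
    ∫⁻ t, k t * ∫⁻ x, F x (x + t) = ∫⁻ x, ∫⁻ s, k (s - x) * F x s := by
  have hm : ∀ t, Measurable fun x ↦ F x (x + t) := fun t ↦
    hF.comp (measurable_id.prodMk (measurable_id.add_const t))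
  have h1 : ∀ t, k t * ∫⁻ x, F x (x + t) = ∫⁻ x, k t * F x (x + t) := fun t ↦ by
    rw [lintegral_const_mul _ (hm t)]
  simp_rw [h1]
  have hG : Measurable (Function.uncurry fun t x ↦ k t * F x (x + t)) :=
    (hk.comp measurable_fst).mul
      (hF.comp (measurable_snd.prodMk (measurable_snd.add measurable_fst)))
  rw [lintegral_lintegral_swap hG.aemeasurable]
  refine lintegral_congr fun x ↦ ?_
  have h2 := lintegral_add_right_eq_self (μ := (volume : Measure ℝ))
    (fun s ↦ k (s - x) * F x s) x
  rw [← h2]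
  refine lintegral_congr fun t ↦ ?_
  rw [add_sub_cancel_right, add_comm t x]

/-- Renaming the pair: `∫∫ G(x, s) ds dx = ∫∫ G(s, x) ds dx` (Tonelli). -/
theorem lintegral_lintegral_comm {G : ℝ → ℝ → ℝ≥0∞} (hG : Measurable (Function.uncurry G)) :
    ∫⁻ x, ∫⁻ s, G x s = ∫⁻ x, ∫⁻ s, G s x :=
  lintegral_lintegral_swap hG.aemeasurable

/-- **Splitting the line at `0`**: `∫ F = ∫_{x>0} F(x) + ∫_{x>0} F(−x)` (the origin is null and
Lebesgue measure is reflection invariant). -/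
theorem lintegral_eq_setLIntegral_Ioi_add (F : ℝ → ℝ≥0∞) :
    ∫⁻ x, F x = (∫⁻ x in Ioi (0 : ℝ), F x) + ∫⁻ x in Ioi (0 : ℝ), F (-x) := by
  rw [← lintegral_add_compl F (measurableSet_Ioi (a := (0 : ℝ))), compl_Ioi,
    ← restrict_Iio_eq_restrict_Iic]
  congr 1
  have h1 : ∫⁻ x in Iio (0 : ℝ), F x = ∫⁻ x, (Iio (0 : ℝ)).indicator F (-x) := by
    rw [← lintegral_indicator measurableSet_Iio, lintegral_neg_eq_self]
  have h2 : ∫⁻ x in Ioi (0 : ℝ), F (-x) = ∫⁻ x, (Ioi (0 : ℝ)).indicator (fun y ↦ F (-y)) x := by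
    rw [← lintegral_indicator measurableSet_Ioi]
  rw [h1, h2]
  refine lintegral_congr fun x ↦ ?_
  by_cases hx : 0 < x
  · have hx' : -x ∈ Iio (0 : ℝ) := by simpa using hx
    rw [indicator_of_mem hx', indicator_of_mem (mem_Ioi.2 hx)]
  · have hx' : -x ∉ Iio (0 : ℝ) := by simpa using hx
    rw [indicator_of_notMem hx', indicator_of_notMem (fun h ↦ hx (mem_Ioi.1 h))]

/-- **Quadrant decomposition**: `∫∫_{ℝ²} G = ∫∫_{x,s>0} (G(x,s) + G(x,−s) + G(−x,s) + G(−x,−s))`. -/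
theorem lintegral_lintegral_eq_quadrant {G : ℝ → ℝ → ℝ≥0∞}
    (hG : Measurable (Function.uncurry G)) :
    ∫⁻ x, ∫⁻ s, G x s = ∫⁻ x in Ioi (0 : ℝ), ∫⁻ s in Ioi (0 : ℝ),
      (G x s + G x (-s) + (G (-x) s + G (-x) (-s))) := by
  have hm : ∀ x, Measurable (G x) := fun x ↦ hG.comp measurable_prodMk_left
  have hmn : ∀ x, Measurable fun s ↦ G x (-s) := fun x ↦ (hm x).comp measurable_neg
  have hinner : ∀ y, ∫⁻ s, G y s = ∫⁻ s in Ioi (0 : ℝ), (G y s + G y (-s)) := fun y ↦ by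
    rw [lintegral_eq_setLIntegral_Ioi_add (G y), ← lintegral_add_left (hm y)]
  rw [lintegral_eq_setLIntegral_Ioi_add (fun x ↦ ∫⁻ s, G x s)]
  simp only [hinner]
  have hmeas : Measurable fun x ↦ ∫⁻ s in Ioi (0 : ℝ), (G x s + G x (-s)) := by
    have h := Measurable.lintegral_prod_right' (ν := (volume : Measure ℝ).restrict (Ioi 0))
      (f := fun p : ℝ × ℝ ↦ G p.1 p.2 + G p.1 (-p.2))
      (hG.add (hG.comp (measurable_fst.prodMk measurable_snd.neg)))
    exact h
  rw [← lintegral_add_left hmeas]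
  refine lintegral_congr fun x ↦ ?_
  have hmx : Measurable fun s ↦ G x s + G x (-s) := (hm x).add (hmn x)
  rw [← lintegral_add_left hmx]

/-! ## The pointwise folded-kernel inequality -/

/-- Elementary rearrangement: `K a_h + P b_h ≤ K a_g + P b_g` when `P ≤ K` (or `a_h = a_g = 0`),
`P ≥ 0`, `a_h ≤ a_g` and `a_h + b_h ≤ a_g + b_g`
(`K a + P b = (K − P) a + P (a + b)`). -/
theorem fold_core_real {K P ah bh ag bg : ℝ} (hK : P ≤ K ∨ (ah = 0 ∧ ag = 0)) (hP : 0 ≤ P)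
    (ha : ah ≤ ag) (hab : ah + bh ≤ ag + bg) :
    K * ah + P * bh ≤ K * ag + P * bg := by
  rcases hK with hPK | ⟨h1, h2⟩
  · have e1 : K * ah + P * bh = (K - P) * ah + P * (ah + bh) := by ring
    have e2 : K * ag + P * bg = (K - P) * ag + P * (ag + bg) := by ring
    rw [e1, e2]
    exact add_le_add (mul_le_mul_of_nonneg_left ha (sub_nonneg.2 hPK))
      (mul_le_mul_of_nonneg_left hab hP)
  · subst h1
    subst h2
    have : P * bh ≤ P * bg := mul_le_mul_of_nonneg_left (by linarith) hP
    linarith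

/-- `|u − v|² + |u + v|² = 2|u|² + 2|v|²` in `ℂ` (parallelogram law). -/
theorem norm_sub_sq_add_norm_add_sq (u v : ℂ) :
    ‖u - v‖ ^ 2 + ‖u + v‖ ^ 2 = 2 * ‖u‖ ^ 2 + 2 * ‖v‖ ^ 2 := by
  have h := parallelogram_law_with_norm ℂ u v
  nlinarith [h]

/-- **The pointwise folded-kernel inequality** (extended-real form): for a same-side kernel value
`K ≥ P ≥ 0` (or coinciding points), the opposite-side value `P`, and values with
`|h(s) − h(x)| ≤ |g(s) − g(x)|`, `|h(x)| ≤ |g(x)|`, `|h(s)| ≤ |g(s)|`: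
`K|h(s)−h(x)|² + P|h(s)+h(x)|² ≤ K|g(s)−g(x)|² + P|g(s)+g(x)|²`. -/
theorem fold_pointwise {hx hs gx gs : ℂ} {K P : ℝ} (hK0 : 0 ≤ K) (hP : 0 ≤ P)
    (hK : P ≤ K ∨ (hs = hx ∧ gs = gx)) (hd : ‖hs - hx‖ ≤ ‖gs - gx‖) (hnx : ‖hx‖ ≤ ‖gx‖)
    (hns : ‖hs‖ ≤ ‖gs‖) :
    ENNReal.ofReal K * ENNReal.ofReal (‖hs - hx‖ ^ 2) +
        ENNReal.ofReal P * ENNReal.ofReal (‖hs + hx‖ ^ 2) ≤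
      ENNReal.ofReal K * ENNReal.ofReal (‖gs - gx‖ ^ 2) +
        ENNReal.ofReal P * ENNReal.ofReal (‖gs + gx‖ ^ 2) := by
  rw [← ENNReal.ofReal_mul hK0, ← ENNReal.ofReal_mul hP, ← ENNReal.ofReal_mul hK0,
    ← ENNReal.ofReal_mul hP, ← ENNReal.ofReal_add (by positivity) (by positivity),
    ← ENNReal.ofReal_add (by positivity) (by positivity)]
  refine ENNReal.ofReal_le_ofReal (fold_core_real ?_ hP ?_ ?_)
  · rcases hK with h | ⟨h1, h2⟩
    · exact Or.inl h
    · exact Or.inr ⟨by simp [h1], by simp [h2]⟩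
  · exact pow_le_pow_left₀ (norm_nonneg _) hd 2
  · rw [norm_sub_sq_add_norm_add_sq, norm_sub_sq_add_norm_add_sq]
    nlinarith [pow_le_pow_left₀ (norm_nonneg _) hnx 2, pow_le_pow_left₀ (norm_nonneg _) hns 2]

/-! ## The folded-kernel inequality for the archimedean energy -/

/-- Measurability of the pair energy `(x, s) ↦ ofReal |f(s) − f(x)|²`. -/
theorem measurable_pairEnergy {f : ℝ → ℂ} (hf : Measurable f) :
    Measurable (Function.uncurry fun x s : ℝ ↦ ENNReal.ofReal (‖f s - f x‖ ^ 2)) :=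
  ENNReal.measurable_ofReal.comp
    (((hf.comp measurable_snd).sub (hf.comp measurable_fst)).norm.pow_const 2)

/-- **Quadrant form of the archimedean energy.** With the half-line kernel `k = 𝟙_{(0,∞)} ρ` and
`G_f(x, s) = (k(s−x) + k(x−s)) |f(s) − f(x)|²` (as extended reals):
`2 ∫₀^∞ ρ(t) (∫ |f(x+t) − f(x)|² dx) dt = ∫∫_{x,s>0} (G_f(x,s) + G_f(x,−s) + G_f(−x,s) + G_f(−x,−s))`
for every measurable `f`. -/
theorem two_mul_lintegral_arch_eq_quadrant {f : ℝ → ℂ} (hf : Measurable f) :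
    2 * (∫⁻ t in Ioi (0 : ℝ), ENNReal.ofReal (weilArchDensity t) *
        ∫⁻ x, ENNReal.ofReal (‖f (x + t) - f x‖ ^ 2)) =
      ∫⁻ x in Ioi (0 : ℝ), ∫⁻ s in Ioi (0 : ℝ),
        ((ENNReal.ofReal ((Ioi (0 : ℝ)).indicator weilArchDensity (s - x)) +
            ENNReal.ofReal ((Ioi (0 : ℝ)).indicator weilArchDensity (x - s))) *
            ENNReal.ofReal (‖f s - f x‖ ^ 2) +
          (ENNReal.ofReal ((Ioi (0 : ℝ)).indicator weilArchDensity (-s - x)) +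
            ENNReal.ofReal ((Ioi (0 : ℝ)).indicator weilArchDensity (x - -s))) *
            ENNReal.ofReal (‖f (-s) - f x‖ ^ 2) +
          ((ENNReal.ofReal ((Ioi (0 : ℝ)).indicator weilArchDensity (s - -x)) +
            ENNReal.ofReal ((Ioi (0 : ℝ)).indicator weilArchDensity (-x - s))) *
            ENNReal.ofReal (‖f s - f (-x)‖ ^ 2) +
          (ENNReal.ofReal ((Ioi (0 : ℝ)).indicator weilArchDensity (-s - -x)) +
            ENNReal.ofReal ((Ioi (0 : ℝ)).indicator weilArchDensity (-x - -s))) *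
            ENNReal.ofReal (‖f (-s) - f (-x)‖ ^ 2))) := by
  set kr : ℝ → ℝ := (Ioi (0 : ℝ)).indicator weilArchDensity with hkr
  set E : ℝ → ℝ → ℝ≥0∞ := fun x s ↦ ENNReal.ofReal (‖f s - f x‖ ^ 2) with hE
  have hkrm : Measurable kr := measurable_weilArchDensity.indicator measurableSet_Ioi
  have hkm : Measurable fun t ↦ ENNReal.ofReal (kr t) := ENNReal.measurable_ofReal.comp hkrm
  have hEm : Measurable (Function.uncurry E) := measurable_pairEnergy hf
  have hEsymm : ∀ x s, E s x = E x s := fun x s ↦ by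
    simp only [hE, norm_sub_rev]
  -- (a) the half-line kernel
  have ha : (∫⁻ t in Ioi (0 : ℝ), ENNReal.ofReal (weilArchDensity t) *
      ∫⁻ x, ENNReal.ofReal (‖f (x + t) - f x‖ ^ 2)) =
      ∫⁻ t, ENNReal.ofReal (kr t) * ∫⁻ x, E x (x + t) := by
    rw [← lintegral_indicator measurableSet_Ioi]
    refine lintegral_congr fun t ↦ ?_
    by_cases ht : t ∈ Ioi (0 : ℝ)
    · rw [indicator_of_mem ht, hkr, indicator_of_mem ht]
    · rw [indicator_of_notMem ht, hkr, indicator_of_notMem ht, ENNReal.ofReal_zero, zero_mul]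
  -- (b) pair coordinates
  have hb : (∫⁻ t, ENNReal.ofReal (kr t) * ∫⁻ x, E x (x + t)) =
      ∫⁻ x, ∫⁻ s, ENNReal.ofReal (kr (s - x)) * E x s := lintegral_kernel_shift hkm hEm
  -- (c) the mirrored pair coordinates
  have hG₁ : Measurable (Function.uncurry fun x s ↦ ENNReal.ofReal (kr (s - x)) * E x s) :=
    (hkm.comp (measurable_snd.sub measurable_fst)).mul hEm
  have hc : (∫⁻ x, ∫⁻ s, ENNReal.ofReal (kr (s - x)) * E x s) =
      ∫⁻ x, ∫⁻ s, ENNReal.ofReal (kr (x - s)) * E x s := by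
    rw [lintegral_lintegral_comm hG₁]
    refine lintegral_congr fun x ↦ lintegral_congr fun s ↦ ?_
    rw [hEsymm]
  -- (d) add the two representations
  have hB : Measurable fun x ↦ ∫⁻ s, ENNReal.ofReal (kr (s - x)) * E x s :=
    hG₁.lintegral_prod_right'
  have hd : 2 * (∫⁻ t, ENNReal.ofReal (kr t) * ∫⁻ x, E x (x + t)) =
      ∫⁻ x, ∫⁻ s, (ENNReal.ofReal (kr (s - x)) + ENNReal.ofReal (kr (x - s))) * E x s := by
    have h2 : 2 * (∫⁻ t, ENNReal.ofReal (kr t) * ∫⁻ x, E x (x + t)) =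
        (∫⁻ x, ∫⁻ s, ENNReal.ofReal (kr (s - x)) * E x s) +
          ∫⁻ x, ∫⁻ s, ENNReal.ofReal (kr (x - s)) * E x s := by
      rw [two_mul, ← hc, hb]
    rw [h2, ← lintegral_add_left hB]
    refine lintegral_congr fun x ↦ ?_
    have hmx : Measurable fun s ↦ ENNReal.ofReal (kr (s - x)) * E x s :=
      hG₁.comp measurable_prodMk_left
    rw [← lintegral_add_left hmx]
    refine lintegral_congr fun s ↦ ?_
    simp only [add_mul]
  -- (e) quadrants
  have hG : Measurable (Function.uncurry fun x s ↦
      (ENNReal.ofReal (kr (s - x)) + ENNReal.ofReal (kr (x - s))) * E x s) :=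
    ((hkm.comp (measurable_snd.sub measurable_fst)).add
      (hkm.comp (measurable_fst.sub measurable_snd))).mul hEm
  rw [ha, hd, lintegral_lintegral_eq_quadrant hG]

/-- **The folded-kernel inequality** (lower-Lebesgue form). Let `g, h : ℝ → ℂ` be measurable and
ODD, with `|h(s) − h(x)| ≤ |g(s) − g(x)|` and `|h(x)| ≤ |g(x)|` for all `x, s > 0`. Then
`∫₀^∞ ρ(t) ∫ |h(x+t) − h(x)|² dx dt ≤ ∫₀^∞ ρ(t) ∫ |g(x+t) − g(x)|² dx dt`. In the quadrant form
the two sides are integrals over `x, s > 0` of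
`2 (K |f(s) − f(x)|² + ρ(x+s) |f(s) + f(x)|²)`, `K = ρ(|s − x|) ≥ ρ(x+s)` (`ρ` non-increasing),
and the integrand for `h` is pointwise below the one for `g` (`fold_pointwise`). -/
theorem lintegral_arch_fold_le {g h : ℝ → ℂ} (hgm : Measurable g) (hhm : Measurable h)
    (hgo : ∀ x, g (-x) = -g x) (hho : ∀ x, h (-x) = -h x)
    (hd : ∀ x s, 0 < x → 0 < s → ‖h s - h x‖ ≤ ‖g s - g x‖)
    (hn : ∀ x, 0 < x → ‖h x‖ ≤ ‖g x‖) :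
    (∫⁻ t in Ioi (0 : ℝ), ENNReal.ofReal (weilArchDensity t) *
        ∫⁻ x, ENNReal.ofReal (‖h (x + t) - h x‖ ^ 2)) ≤
      ∫⁻ t in Ioi (0 : ℝ), ENNReal.ofReal (weilArchDensity t) *
        ∫⁻ x, ENNReal.ofReal (‖g (x + t) - g x‖ ^ 2) := by
  rw [← ENNReal.mul_le_mul_iff_right (a := 2) two_ne_zero ENNReal.ofNat_ne_top,
    two_mul_lintegral_arch_eq_quadrant hhm, two_mul_lintegral_arch_eq_quadrant hgm]
  refine setLIntegral_mono' measurableSet_Ioi fun x (hx : 0 < x) ↦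
    setLIntegral_mono' measurableSet_Ioi fun s (hs : 0 < s) ↦ ?_
  -- the half-line kernel
  set kr : ℝ → ℝ := (Ioi (0 : ℝ)).indicator weilArchDensity with hkr
  have hk_pos : ∀ t, 0 < t → kr t = weilArchDensity t := fun t ht ↦ by
    rw [hkr, indicator_of_mem (mem_Ioi.2 ht)]
  have hk_npos : ∀ t, t ≤ 0 → kr t = 0 := fun t ht ↦ by
    rw [hkr, indicator_of_notMem (fun h' ↦ not_lt.2 ht (mem_Ioi.1 h'))]
  have hkr0 : ∀ t, 0 ≤ kr t := fun t ↦ by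
    rcases le_or_gt t 0 with ht | ht
    · rw [hk_npos t ht]
    · rw [hk_pos t ht]; exact (weilArchDensity_pos ht).le
  -- normalise the kernel arguments
  have e2 : x - -s = x + s := by ring
  have e3 : s - -x = x + s := by ring
  have e5 : -s - -x = x - s := by ring
  have e6 : -x - -s = s - x := by ring
  rw [hk_npos _ (by linarith : -s - x ≤ 0), e2, e3, hk_npos _ (by linarith : -x - s ≤ 0), e5, e6,
    hk_pos _ (by linarith : 0 < x + s)]
  simp only [ENNReal.ofReal_zero, zero_add, add_zero]
  -- oddness
  have oh1 : ‖h (-s) - h x‖ = ‖h s + h x‖ := by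
    rw [hho, show -h s - h x = -(h s + h x) by ring, norm_neg]
  have oh2 : ‖h s - h (-x)‖ = ‖h s + h x‖ := by rw [hho, sub_neg_eq_add]
  have oh3 : ‖h (-s) - h (-x)‖ = ‖h s - h x‖ := by
    rw [hho, hho, show -h s - -h x = -(h s - h x) by ring, norm_neg]
  have og1 : ‖g (-s) - g x‖ = ‖g s + g x‖ := by
    rw [hgo, show -g s - g x = -(g s + g x) by ring, norm_neg]
  have og2 : ‖g s - g (-x)‖ = ‖g s + g x‖ := by rw [hgo, sub_neg_eq_add]
  have og3 : ‖g (-s) - g (-x)‖ = ‖g s - g x‖ := by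
    rw [hgo, hgo, show -g s - -g x = -(g s - g x) by ring, norm_neg]
  rw [oh1, oh2, oh3, og1, og2, og3,
    add_comm (ENNReal.ofReal (kr (x - s))) (ENNReal.ofReal (kr (s - x))),
    ← ENNReal.ofReal_add (hkr0 _) (hkr0 _)]
  -- the pointwise inequality
  have hP : 0 ≤ weilArchDensity (x + s) := (weilArchDensity_pos (by linarith)).le
  have hK0 : 0 ≤ kr (s - x) + kr (x - s) := add_nonneg (hkr0 _) (hkr0 _)
  have hK : weilArchDensity (x + s) ≤ kr (s - x) + kr (x - s) ∨ (h s = h x ∧ g s = g x) := by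
    rcases lt_trichotomy x s with hlt | heq | hgt
    · refine Or.inl ?_
      rw [hk_pos _ (sub_pos.2 hlt), hk_npos _ (by linarith), add_zero]
      exact weilArchDensity_antitoneOn (mem_Ioi.2 (sub_pos.2 hlt)) (mem_Ioi.2 (by linarith))
        (by linarith)
    · subst heq
      exact Or.inr ⟨rfl, rfl⟩
    · refine Or.inl ?_
      rw [hk_npos _ (by linarith), hk_pos _ (sub_pos.2 hgt), zero_add]
      exact weilArchDensity_antitoneOn (mem_Ioi.2 (sub_pos.2 hgt)) (mem_Ioi.2 (by linarith))
        (by linarith)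
  have hmain := fold_pointwise hK0 hP hK (hd x s hx hs) (hn x hx) (hn s hs)
  calc ENNReal.ofReal (kr (s - x) + kr (x - s)) * ENNReal.ofReal (‖h s - h x‖ ^ 2) +
        ENNReal.ofReal (weilArchDensity (x + s)) * ENNReal.ofReal (‖h s + h x‖ ^ 2) +
        (ENNReal.ofReal (weilArchDensity (x + s)) * ENNReal.ofReal (‖h s + h x‖ ^ 2) +
          ENNReal.ofReal (kr (s - x) + kr (x - s)) * ENNReal.ofReal (‖h s - h x‖ ^ 2))
      = 2 * (ENNReal.ofReal (kr (s - x) + kr (x - s)) * ENNReal.ofReal (‖h s - h x‖ ^ 2) +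
          ENNReal.ofReal (weilArchDensity (x + s)) * ENNReal.ofReal (‖h s + h x‖ ^ 2)) := by
        ring
    _ ≤ 2 * (ENNReal.ofReal (kr (s - x) + kr (x - s)) * ENNReal.ofReal (‖g s - g x‖ ^ 2) +
          ENNReal.ofReal (weilArchDensity (x + s)) * ENNReal.ofReal (‖g s + g x‖ ^ 2)) :=
        mul_le_mul_right hmain 2
    _ = _ := by ring

/-- `ofReal` of the archimedean energy of a test function is the lower Lebesgue integral
`∫₀^∞ ofReal(ρ(t)) ∫ ofReal |f(x+t) − f(x)|² dx dt` (all integrands are non-negative and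
integrable, `integrableOn_weilArchDensity_mul_weilIncrement`). -/
theorem lintegral_arch_eq_ofReal {f : ℝ → ℂ} (hf : IsWeilTest f) :
    (∫⁻ t in Ioi (0 : ℝ), ENNReal.ofReal (weilArchDensity t) *
        ∫⁻ x, ENNReal.ofReal (‖f (x + t) - f x‖ ^ 2)) =
      ENNReal.ofReal (∫ t in Ioi (0 : ℝ), weilArchDensity t * weilIncrement f t) := by
  rw [ofReal_integral_eq_lintegral_ofReal (integrableOn_weilArchDensity_mul_weilIncrement hf)
    ((ae_restrict_iff' measurableSet_Ioi).2 (Eventually.of_forall fun t ht ↦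
      mul_nonneg (weilArchDensity_pos ht).le (weilIncrement_nonneg f t)))]
  refine setLIntegral_congr_fun measurableSet_Ioi fun t ht ↦ ?_
  rw [ENNReal.ofReal_mul (weilArchDensity_pos ht).le, weilIncrement,
    ofReal_integral_eq_lintegral_ofReal (integrable_weilIncrement_integrand hf.memLp_two t)
      (Eventually.of_forall fun x ↦ by positivity)]

/-- **The folded-kernel inequality for the archimedean energy.** For odd test functions `g, h` with
`|h(s) − h(x)| ≤ |g(s) − g(x)|` and `|h(x)| ≤ |g(x)|` for all `x, s > 0`,
`∫₀^∞ ρ(t) D_t(h) dt ≤ ∫₀^∞ ρ(t) D_t(g) dt`. -/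
theorem setIntegral_weilArchDensity_mul_weilIncrement_fold_le {g h : ℝ → ℂ} (hg : IsWeilTest g)
    (hh : IsWeilTest h) (hgo : ∀ x, g (-x) = -g x) (hho : ∀ x, h (-x) = -h x)
    (hd : ∀ x s, 0 < x → 0 < s → ‖h s - h x‖ ≤ ‖g s - g x‖)
    (hn : ∀ x, 0 < x → ‖h x‖ ≤ ‖g x‖) :
    ∫ t in Ioi (0 : ℝ), weilArchDensity t * weilIncrement h t ≤
      ∫ t in Ioi (0 : ℝ), weilArchDensity t * weilIncrement g t := by
  have h1 := lintegral_arch_fold_le hg.1.continuous.measurable hh.1.continuous.measurable hgo hho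
    hd hn
  rw [lintegral_arch_eq_ofReal hg, lintegral_arch_eq_ofReal hh] at h1
  exact (ENNReal.ofReal_le_ofReal_iff (setIntegral_nonneg measurableSet_Ioi fun t ht ↦
    mul_nonneg (weilArchDensity_pos ht).le (weilIncrement_nonneg g t))).1 h1

end Summit.RiemannHypothesis.RiemannHypothesis.Theorems.OddArchAnchor

end
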